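import Summits.HubbardSuperconductivity.HubbardSuperconductivity.Theorems.WindowGap.Negative.TwistCeiling
import Mathlib.Analysis.Real.Pi.Bounds

/-!
# Crux `WindowGap` (stmt-HubbardSuperconductivity-1088): the twist ceiling, III —
# the certified margin of a witness decays like `1/C²` in the tail allowance

The crux `WindowGap` asks, at some `(U, δ)`, for EVERY tail allowance `C ≥ 0` (and every `ε₀ > 0`)
a window radius `ε ≤ ε₀`, a penalty `λ > 0` and an order constant `a > 0` with
`λ(Cε + a)L² ≤ minEnergyOn (H_L + λW_ε) K_L − minEnergyOn H_L K_L` eventually in even `L`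
(`H_L = hubbardTorus 2 L 1 U`, `K_L = szSector N_L 0`, `N_L = 2⌊(1−δ)L²/2⌋`,
`W_ε = L⁻² Σ_{|q_m| ≤ ε} Δ_d(m)ᴴ Δ_d(m)`). The number `M := λ(Cε + a)` is the MARGIN per site that any
engine certifying the witness (a lower bound on the penalised sector energy density against an
upper bound on the unpenalised one) has to resolve. This module bounds it from the landed twist
ceiling `windowGap_twistCeiling` (part II), unconditionally in `U`:

* `windowGap_margin_le_of_slope` — for every slope `γ ∈ (0, 1/8]` (twist windings `|j| ≤ ⌊γL⌋`):
  `λ(Cε + a) ≤ 8π²γ² + 25λε/(πγ)` (let `L → ∞` along the even sides in the ceiling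
  `8π²J² + 50λ(2⌊εL/2π⌋ + 1)L²/(2J + 1)` with `J = ⌊γL⌋`);
* `windowGap_margin_decay` — for `C ≥ 128`, `ε > 0`, `a ≥ 0`: `λ(Cε + a) ≤ 4·10⁴ / C²`
  (slope `γ = 50/(πC) ≤ 1/8`: the window term `25λε/(πγ) = λCε/2` is at most half the margin).

Reading (ENGINE-CENSUS-r2 Finding A / strategist census §7.4, now a tree fact): because `ε` is
chosen AFTER the adversarial `C`, the margins of the witnesses a proof of the crux must exhibit tend
to `0` as `C → ∞` — no certificate family of FIXED resolution can serve the crux's `∀ C`, whatever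
`(U, δ)`; with the saturation bound `λ(Cε + a) ≤ 4(1 − δ)` (`PenaltySaturation`) the margin is
`≤ min (4(1−δ), 4·10⁴/C²)`. Support / negative for the crux (`--supports stmt-HubbardSuperconductivity-1088`);
no definitions. H. Watanabe, J. Stat. Phys. 177 (2019) 717, §2.2.1 (twist pricing);
E. Lieb, T. Schultz, D. Mattis, Ann. Phys. 16 (1961) 407; H. Tasaki (2020) §2.1.
-/

-- the mandated namespace repeats `HubbardSuperconductivity` (single-problem summit, D-0017)
set_option linter.dupNamespace false

noncomputable section
namespace Summit.HubbardSuperconductivity.HubbardSuperconductivity.Theorems.WindowGap.Negative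

open Matrix Finset Literature.MathematicalPhysics.QuantumLattice
  Literature.Probability.LatticeModels
  Summit.HubbardSuperconductivity.HubbardSuperconductivity.Theorems

/-- **Margin of a witness vs. twist slope.** Let `U, δ ≥ −1`, `ε, λ ≥ 0`, `C, a` be real and suppose
the crux inequality `λ(Cε + a)L² ≤ minEnergyOn (H_L + λW_ε) K_L − minEnergyOn H_L K_L` holds at all
large even `L`. Then for every slope `0 < γ ≤ 1/8`:
`λ(Cε + a) ≤ 8π²γ² + 25λε/(πγ)`.
Proof: at an even side `L = 2K` beyond the threshold take `J = ⌊γL⌋` (so `4J < L`) and a unit sector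
ground state (`exists_unit_groundStateInSector_hubbardTorus`) in `windowGap_twistCeiling`:
`λ(Cε+a)L² ≤ 8π²J² + 50λ(2⌊εL/2π⌋+1)L²/(2J+1) ≤ 8π²γ²L² + 50λ(εL/π + 1)L²/(2γL − 1)`, and the last
term is `< (25λε/(πγ) + η)L²` once `η(2γL − 1) > 50λ + 25λε/(πγ)`; `η > 0` is arbitrary.
Watanabe (2019) §2.2.1; Tasaki (2020) §2.1. [folklore] -/
theorem windowGap_margin_le_of_slope {U δ C ε lam a γ : ℝ} (hδ : -1 ≤ δ) (hε : 0 ≤ ε)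
    (hlam : 0 ≤ lam) (hγ : 0 < γ) (hγ8 : γ ≤ 1 / 8)
    (hgap : ∃ L₀ : ℕ, ∀ (L : ℕ) [NeZero L], L₀ ≤ L → Even L →
      lam * (C * ε + a) * (L : ℝ) ^ 2 ≤
        (hubbardTorus 2 L 1 U + (lam : ℂ) • (∑ m : Fin 2 → ZMod L,
            if (2 * Real.pi / (L : ℝ)) ^ 2 * (∑ i : Fin 2, (((m i).valMinAbs : ℤ) : ℝ) ^ 2) ≤ ε ^ 2
            then ((L : ℂ) ^ 2)⁻¹ • (Matrix.conjTranspose (pairFieldAt dWaveFormFactor L m) *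
              pairFieldAt dWaveFormFactor L m)
            else 0)).minEnergyOn (szSector (2 * ⌊(1 - δ) * (L : ℝ) ^ 2 / 2⌋₊) 0) -
          (hubbardTorus 2 L 1 U).minEnergyOn (szSector (2 * ⌊(1 - δ) * (L : ℝ) ^ 2 / 2⌋₊) 0)) :
    lam * (C * ε + a) ≤ 8 * Real.pi ^ 2 * γ ^ 2 + 25 * lam * ε / (Real.pi * γ) := by
  obtain ⟨L₀, hL₀⟩ := hgap
  have hπ : 0 < Real.pi := Real.pi_pos
  have hπγ : 0 < Real.pi * γ := mul_pos hπ hγ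
  refine le_of_forall_pos_lt_add fun η hη => ?_
  -- the threshold: `η (2γL − 1) > 50λ + 25λε/(πγ)`
  set T : ℝ := (50 * lam + 25 * lam * ε / (Real.pi * γ)) / η with hT
  have hT0 : 0 ≤ T := by
    have : 0 ≤ 25 * lam * ε / (Real.pi * γ) := by positivity
    exact div_nonneg (by positivity) hη.le
  obtain ⟨K, hKdef⟩ : ∃ K : ℕ, K = max L₀ (⌈(T + 2) / γ⌉₊ + 2) := ⟨_, rfl⟩
  have hK₀ : L₀ ≤ 2 * K := by
    rw [hKdef]
    exact (le_max_left _ _).trans (Nat.le_mul_of_pos_left _ two_pos)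
  have hK2 : ⌈(T + 2) / γ⌉₊ + 2 ≤ K := hKdef ▸ le_max_right _ _
  haveI : NeZero (2 * K) := ⟨by omega⟩
  have hgapL := hL₀ (2 * K) hK₀ (even_two_mul K)
  have hLge3 : 3 ≤ 2 * K := by omega
  have hLreal : ((2 * K : ℕ) : ℝ) = 2 * (K : ℝ) := by push_cast; ring
  have hKreal : (⌈(T + 2) / γ⌉₊ : ℝ) + 2 ≤ K := by exact_mod_cast hK2
  have hceil : (T + 2) / γ ≤ (⌈(T + 2) / γ⌉₊ : ℝ) := Nat.le_ceil _
  have hKγ : (T + 2) / γ ≤ (K : ℝ) := by linarith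
  have hγK : T + 2 ≤ γ * (K : ℝ) := by
    rw [div_le_iff₀ hγ] at hKγ
    linarith
  -- so `γ L ≥ 2T + 4 ≥ 4` at `L = 2K`
  have hγL : 2 * T + 4 ≤ γ * ((2 * K : ℕ) : ℝ) := by rw [hLreal]; nlinarith
  have hLpos : (0 : ℝ) < ((2 * K : ℕ) : ℝ) := by
    have h4 : 4 ≤ 2 * K := by omega
    have h4' : (4 : ℝ) ≤ ((2 * K : ℕ) : ℝ) := by exact_mod_cast h4
    linarith
  -- the winding range `J = ⌊γ L⌋`
  obtain ⟨J, hJdef⟩ : ∃ J : ℕ, J = ⌊γ * ((2 * K : ℕ) : ℝ)⌋₊ := ⟨_, rfl⟩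
  have hJle : (J : ℝ) ≤ γ * ((2 * K : ℕ) : ℝ) := hJdef ▸ Nat.floor_le (by positivity)
  have hJge : γ * ((2 * K : ℕ) : ℝ) - 1 ≤ J := by
    have := Nat.lt_floor_add_one (γ * ((2 * K : ℕ) : ℝ))
    rw [← hJdef] at this
    linarith
  have h4J : 4 * J < 2 * K := by
    have h1 : (4 * J : ℝ) ≤ 4 * (γ * ((2 * K : ℕ) : ℝ)) := by linarith
    have h2 : 4 * (γ * ((2 * K : ℕ) : ℝ)) ≤ ((2 * K : ℕ) : ℝ) / 2 := by nlinarith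
    have h3 : ((2 * K : ℕ) : ℝ) / 2 < ((2 * K : ℕ) : ℝ) := by linarith
    have h4 : (4 * J : ℝ) < ((2 * K : ℕ) : ℝ) := by linarith
    exact_mod_cast h4
  -- a sector ground state at the side `2K`
  obtain ⟨ψ, hψ1, hgs⟩ :=
    Summit.HubbardSuperconductivity.NoGo.exists_unit_groundStateInSector_hubbardTorus (2 * K) 1 U
      (Summit.HubbardSuperconductivity.NoGo.floor_pairNumber_le δ hδ (2 * K))
  have hE : (star ψ ⬝ᵥ (hubbardTorus 2 (2 * K) 1 U *ᵥ ψ)).re =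
      (hubbardTorus 2 (2 * K) 1 U).minEnergyOn
        (szSector (2 * ⌊(1 - δ) * ((2 * K : ℕ) : ℝ) ^ 2 / 2⌋₊) 0) := by
    rw [hgs.2.2, dotProduct_smul, hψ1, smul_eq_mul, mul_one, Complex.ofReal_re]
  have hdw : ∀ e : Site 2, |dWaveFormFactor e| ≤ 1 := fun e => by
    unfold dWaveFormFactor
    split_ifs <;> norm_num
  have hceiling := windowGap_twistCeiling hLge3 U _ 0 dWaveFormFactor hdw hε hlam h4J hgs.1 hψ1 hE
    (ε := ε)
  -- name the pieces
  set Lr : ℝ := ((2 * K : ℕ) : ℝ) with hLr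
  set M : ℝ := lam * (C * ε + a) with hM
  have hL2pos : (0 : ℝ) < Lr ^ 2 := by positivity
  -- kinetic part: `8π²J² ≤ 8π²γ²L²`
  have hkin : 8 * Real.pi ^ 2 * (J : ℝ) ^ 2 ≤ 8 * Real.pi ^ 2 * γ ^ 2 * Lr ^ 2 := by
    have h1 : (J : ℝ) ^ 2 ≤ (γ * Lr) ^ 2 := pow_le_pow_left₀ (Nat.cast_nonneg _) hJle 2
    calc 8 * Real.pi ^ 2 * (J : ℝ) ^ 2 ≤ 8 * Real.pi ^ 2 * (γ * Lr) ^ 2 :=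
          mul_le_mul_of_nonneg_left h1 (by positivity)
      _ = 8 * Real.pi ^ 2 * γ ^ 2 * Lr ^ 2 := by ring
  -- window part: `50λ(2⌊εL/2π⌋+1)L²/(2J+1) ≤ 50λ(εL/π+1)L²/(2γL−1) < (25λε/(πγ) + η) L²`
  have hR : ((2 * ⌊ε * Lr / (2 * Real.pi)⌋₊ + 1 : ℕ) : ℝ) ≤ ε * Lr / Real.pi + 1 := by
    have hfl : (⌊ε * Lr / (2 * Real.pi)⌋₊ : ℝ) ≤ ε * Lr / (2 * Real.pi) :=
      Nat.floor_le (by positivity)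
    have heq : 2 * (ε * Lr / (2 * Real.pi)) = ε * Lr / Real.pi := by
      field_simp
    push_cast
    linarith
  have hden : 2 * γ * Lr - 1 ≤ 2 * (J : ℝ) + 1 := by linarith
  have hdenpos : 0 < 2 * γ * Lr - 1 := by linarith
  have hJpos : (0 : ℝ) < 2 * J + 1 := by positivity
  have hwin1 : 50 * lam * ((2 * ⌊ε * Lr / (2 * Real.pi)⌋₊ + 1 : ℕ) : ℝ) * Lr ^ 2 / (2 * J + 1) ≤
      50 * lam * (ε * Lr / Real.pi + 1) * Lr ^ 2 / (2 * γ * Lr - 1) := by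
    have hnum : 50 * lam * ((2 * ⌊ε * Lr / (2 * Real.pi)⌋₊ + 1 : ℕ) : ℝ) * Lr ^ 2 ≤
        50 * lam * (ε * Lr / Real.pi + 1) * Lr ^ 2 := by
      have : 0 ≤ 50 * lam := by positivity
      have : 0 ≤ Lr ^ 2 := sq_nonneg _
      gcongr
    have hnn : 0 ≤ 50 * lam * (ε * Lr / Real.pi + 1) * Lr ^ 2 := by positivity
    calc _ ≤ 50 * lam * (ε * Lr / Real.pi + 1) * Lr ^ 2 / (2 * J + 1) :=
          div_le_div_of_nonneg_right hnum hJpos.le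
      _ ≤ _ := div_le_div_of_nonneg_left hnn hdenpos hden
  -- the threshold inequality `η(2γL − 1) > 50λ + 25λε/(πγ)`
  have hthr : 50 * lam + 25 * lam * ε / (Real.pi * γ) < η * (2 * γ * Lr - 1) := by
    have h1 : T * η = 50 * lam + 25 * lam * ε / (Real.pi * γ) := by
      rw [hT, div_mul_cancel₀ _ hη.ne']
    have h2 : T < 2 * γ * Lr - 1 := by linarith
    have h3 := mul_lt_mul_of_pos_right h2 hη
    linarith
  have hwin2 : 50 * lam * (ε * Lr / Real.pi + 1) * Lr ^ 2 / (2 * γ * Lr - 1) <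
      (25 * lam * ε / (Real.pi * γ) + η) * Lr ^ 2 := by
    rw [div_lt_iff₀ hdenpos]
    -- expand: RHS·(2γL−1) = 50λεL³/π·… ; reduce to `hthr · L²`
    have hid : (25 * lam * ε / (Real.pi * γ) + η) * Lr ^ 2 * (2 * γ * Lr - 1) =
        50 * lam * (ε * Lr / Real.pi) * Lr ^ 2 +
          (η * (2 * γ * Lr - 1) - 25 * lam * ε / (Real.pi * γ)) * Lr ^ 2 := by
      field_simp
      ring
    rw [hid]
    have h3 : 50 * lam * (ε * Lr / Real.pi + 1) * Lr ^ 2 =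
        50 * lam * (ε * Lr / Real.pi) * Lr ^ 2 + 50 * lam * Lr ^ 2 := by ring
    rw [h3]
    have h4 : 50 * lam * Lr ^ 2 < (η * (2 * γ * Lr - 1) - 25 * lam * ε / (Real.pi * γ)) * Lr ^ 2 :=
      mul_lt_mul_of_pos_right (by linarith) hL2pos
    linarith
  -- assemble and divide by `L²`
  have htot : M * Lr ^ 2 < (8 * Real.pi ^ 2 * γ ^ 2 + 25 * lam * ε / (Real.pi * γ) + η) * Lr ^ 2 := by
    have := hgapL.trans hceiling
    linarith
  exact lt_of_mul_lt_mul_right htot hL2pos.le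

/-- **The certified margin of a witness is `≤ 4·10⁴/C²`.** Let `U` be real, `δ ≥ −1`, `ε ≥ 0`,
`λ ≥ 0`, `a ≥ 0`, and let the tail allowance be `C ≥ 128`. If the crux
inequality `λ(Cε + a)L² ≤ minEnergyOn (H_L + λW_ε) K_L − minEnergyOn H_L K_L` holds at all large even
`L`, then `λ(Cε + a) ≤ 40000 / C²`. Take the slope `γ = 50/(πC)` in `windowGap_margin_le_of_slope`
(`γ ≤ 1/8` because `πC ≥ 3.14·128 > 400`): `8π²γ² = 2·10⁴/C²` and `25λε/(πγ) = λCε/2 ≤ λ(Cε + a)/2`.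
Hence the margins of the witnesses of `WindowGap` (`ε` chosen after `C`) vanish as the adversarial
tail allowance grows: no fixed-resolution certificate family serves `∀ C`.
Watanabe (2019) §2.2.1; Tasaki (2020) §2.1. [folklore] -/
theorem windowGap_margin_decay {U δ C ε lam a : ℝ} (hδ : -1 ≤ δ) (hε : 0 ≤ ε) (hlam : 0 ≤ lam)
    (ha : 0 ≤ a) (hC : 128 ≤ C)
    (hgap : ∃ L₀ : ℕ, ∀ (L : ℕ) [NeZero L], L₀ ≤ L → Even L →
      lam * (C * ε + a) * (L : ℝ) ^ 2 ≤
        (hubbardTorus 2 L 1 U + (lam : ℂ) • (∑ m : Fin 2 → ZMod L,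
            if (2 * Real.pi / (L : ℝ)) ^ 2 * (∑ i : Fin 2, (((m i).valMinAbs : ℤ) : ℝ) ^ 2) ≤ ε ^ 2
            then ((L : ℂ) ^ 2)⁻¹ • (Matrix.conjTranspose (pairFieldAt dWaveFormFactor L m) *
              pairFieldAt dWaveFormFactor L m)
            else 0)).minEnergyOn (szSector (2 * ⌊(1 - δ) * (L : ℝ) ^ 2 / 2⌋₊) 0) -
          (hubbardTorus 2 L 1 U).minEnergyOn (szSector (2 * ⌊(1 - δ) * (L : ℝ) ^ 2 / 2⌋₊) 0)) :
    lam * (C * ε + a) ≤ 40000 / C ^ 2 := by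
  have hπ := Real.pi_gt_d2
  have hCpos : 0 < C := by linarith
  have hπC : 400 < Real.pi * C := by nlinarith
  set γ : ℝ := 50 / (Real.pi * C) with hγdef
  have hγpos : 0 < γ := div_pos (by norm_num) (by positivity)
  have hγ8 : γ ≤ 1 / 8 := by
    rw [hγdef, div_le_div_iff₀ (by positivity) (by norm_num : (0:ℝ) < 8)]
    linarith
  have hslope := windowGap_margin_le_of_slope (U := U) (C := C) (a := a) hδ hε hlam hγpos hγ8 hgap
  have hkin : 8 * Real.pi ^ 2 * γ ^ 2 = 20000 / C ^ 2 := by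
    rw [hγdef]
    field_simp
    ring
  have hwin : 25 * lam * ε / (Real.pi * γ) = lam * C * ε / 2 := by
    rw [hγdef]
    field_simp
    ring
  rw [hkin, hwin] at hslope
  have hla : 0 ≤ lam * a := mul_nonneg hlam ha
  have h1 : lam * (C * ε + a) ≤ 20000 / C ^ 2 + lam * (C * ε + a) / 2 := by nlinarith
  have h2 : lam * (C * ε + a) / 2 ≤ 20000 / C ^ 2 := by linarith
  calc lam * (C * ε + a) = 2 * (lam * (C * ε + a) / 2) := by ring
    _ ≤ 2 * (20000 / C ^ 2) := by linarith
    _ = 40000 / C ^ 2 := by ring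

end Summit.HubbardSuperconductivity.HubbardSuperconductivity.Theorems.WindowGap.Negative
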